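import Mathlib.NumberTheory.ArithmeticFunction.Liouville
import Mathlib.Algebra.Squarefree.Basic
import Literature.Computability.Complexity.PPolyReductions
import Literature.Computability.Complexity.PPolyComplement
import Literature.Computability.AlgebraicComplexity.BurgisserThm41Proofs
import Literature.Computability.Complexity.StackBricksArith
import Literature.Computability.Complexity.StackBricks
import Literature.Computability.Complexity.PRelHierarchy
import Literature.Computability.Complexity.BranchingFn
import HarnessLib

/-!
# Crux `MobiusLadder.LiouvilleNotPPoly` (stmt-QuantumAdvantage-1389), line `SketchIdeator2` — stub `stub_transfer`

The complexity-plumbing step (K2) of the root-number transfer line: for ANY `w : ℕ → ℤ` that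
agrees with `λ(t)·λ(27t−1)` on the promise `t(27t−1)` squarefree (`t ≥ 1`), a `P/poly` language `L`
answering `λ N = −1` correctly on squarefree `N ≥ 1` yields a `P/poly` language answering
`w t = −1` correctly on the promise.

Construction. The query map `g : bin t ↦ bin (27t − 1)` is a composite of the tree's stack bricks
(`Brick.prodFn`, `Brick.subFn`, `pairFn`, constants), hence in `FP`, and
`L' := (L ⊓ (g⁻¹ L)ᶜ) ⊔ (Lᶜ ⊓ g⁻¹ L)` (the XOR of the two queries `t`, `27t − 1`) is in `P/poly`
by the tree's closure of `P/poly` under `FP`-preimages, complements and intersections. On the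
promise both `t` and `27t − 1 ≥ 1` are squarefree, `λ` takes values `±1` there, and for signs
`a, b ∈ {±1}` exactly one of them is `−1` iff `ab = −1`.
-/

set_option linter.dupNamespace false -- D-0017: single-problem summit ⇒ `QuantumAdvantage.QuantumAdvantage` by design

noncomputable section

namespace Summit.QuantumAdvantage.QuantumAdvantage.Theorems.LiouvilleNotPPoly

open _root_.Computability Literature.Computability.Complexity

namespace StubTransfer

/-- **The query map is polynomial-time**: there is `g ∈ FP` with `g (bin t) = bin (27t − 1)` — the
composite of stack bricks `w ↦ subFn ⟨prodFn ⟨bin 27, w⟩, bin 1⟩` (bricks and pairing are in `FP`,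
`FP` is closed under composition). [folklore] -/
theorem exists_shiftFn :
    ∃ g : List Bool → List Bool, g ∈ FP ∧ ∀ t : ℕ, g (encodeNat t) = encodeNat (27 * t - 1) := by
  refine ⟨Brick.subFn ∘ pairFn (Brick.prodFn ∘ pairFn (fun _ => encodeNat 27) (fun w => w))
    (fun _ => encodeNat 1), ?_, fun t => by simp⟩
  exact comp_mem_FP Brick.subFn_mem_FP
    (pairFn_mem_FP
      (comp_mem_FP Brick.prodFn_mem_FP (pairFn_mem_FP (const_mem_FP _) (PolyTimeComputable.id _)))
      (const_mem_FP _))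

/-- The XOR `(L₁ ⊓ L₂ᶜ) ⊔ (L₁ᶜ ⊓ L₂)` of two `P/poly` languages is in `P/poly` (closure of `P/poly`
under complement and intersection; the union is `(Aᶜ ⊓ Bᶜ)ᶜ`). [folklore] -/
theorem xorLang_mem_PPoly {L₁ L₂ : Language Bool} (h₁ : L₁ ∈ PPoly) (h₂ : L₂ ∈ PPoly) :
    (L₁ ⊓ L₂ᶜ) ⊔ (L₁ᶜ ⊓ L₂) ∈ PPoly := by
  -- adapted from `sup_mem_PPoly` (Theorems/ArithStatLadderIqThreeNotPPolyRURClosure.lean)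
  have hA : L₁ ⊓ L₂ᶜ ∈ PPoly :=
    Literature.Computability.AlgebraicComplexity.inter_mem_PPoly h₁ (compl_mem_PPoly h₂)
  have hB : L₁ᶜ ⊓ L₂ ∈ PPoly :=
    Literature.Computability.AlgebraicComplexity.inter_mem_PPoly (compl_mem_PPoly h₁) h₂
  have h := compl_mem_PPoly (Literature.Computability.AlgebraicComplexity.inter_mem_PPoly
    (compl_mem_PPoly hA) (compl_mem_PPoly hB))
  rwa [compl_inf, compl_compl, compl_compl] at h

/-- For signs `a, b ∈ {±1}`: exactly one of them is `−1` iff `ab = −1`. [folklore] -/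
theorem xor_iff_mul_eq_neg_one {a b : ℤ} (ha : a = 1 ∨ a = -1) (hb : b = 1 ∨ b = -1) :
    ((a = -1 ∧ ¬ b = -1) ∨ (¬ a = -1 ∧ b = -1)) ↔ a * b = -1 := by
  rcases ha with rfl | rfl <;> rcases hb with rfl | rfl <;> decide

end StubTransfer

open StubTransfer in
/-- **STUB A · `stub_transfer`** (two-query closure of `P/poly`): from a `P/poly` language answering
`λ N = −1` on squarefree `N ≥ 1`, a `P/poly` language answering `w t = −1` on the promise
`t(27t − 1)` squarefree, for any `w` equal to `λ(t)λ(27t−1)` there (queries `t` and `27t − 1` through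
an `FP` map `bin t ↦ bin (27t − 1)`, XOR of the answers, Boolean closure of `P/poly`). [folklore] -/
theorem stub_transfer :
    ∀ w : ℕ → ℤ,
    (∀ t : ℕ, 1 ≤ t → Squarefree (t * (27 * t - 1)) →
      w t = ArithmeticFunction.liouville t * ArithmeticFunction.liouville (27 * t - 1)) →
    (∃ L ∈ PPoly, ∀ N : ℕ, 1 ≤ N → Squarefree N →
      (encodeNat N ∈ L ↔ ArithmeticFunction.liouville N = -1)) →
    ∃ L ∈ PPoly, ∀ t : ℕ, 1 ≤ t → Squarefree (t * (27 * t - 1)) →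
      (encodeNat t ∈ L ↔ w t = -1) := by
  intro w hw hL
  obtain ⟨L, hL, hspec⟩ := hL
  obtain ⟨g, hg, hg_apply⟩ := exists_shiftFn
  -- the second query, pulled back along `g`
  obtain ⟨K, hKdef, hK⟩ : ∃ K : Language Bool, (∀ x, x ∈ K ↔ g x ∈ L) ∧ K ∈ PPoly :=
    ⟨g ⁻¹' L, fun _ => Iff.rfl, preimage_mem_PPoly hL hg⟩
  have hsign : ∀ {n : ℕ}, n ≠ 0 →
      ArithmeticFunction.liouville n = 1 ∨ ArithmeticFunction.liouville n = -1 := fun hn => by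
    rw [ArithmeticFunction.liouville_apply hn]
    exact neg_one_pow_eq_or ℤ _
  refine ⟨(L ⊓ Kᶜ) ⊔ (Lᶜ ⊓ K), xorLang_mem_PPoly hL hK, fun t ht hsq => ?_⟩
  have h₁ : encodeNat t ∈ L ↔ ArithmeticFunction.liouville t = -1 :=
    hspec t ht (Squarefree.of_mul_left hsq)
  have h₂ : encodeNat t ∈ K ↔ ArithmeticFunction.liouville (27 * t - 1) = -1 := by
    rw [hKdef, hg_apply]
    exact hspec (27 * t - 1) (by omega) (Squarefree.of_mul_right hsq)
  show (encodeNat t ∈ L ∧ ¬ encodeNat t ∈ K) ∨ (¬ encodeNat t ∈ L ∧ encodeNat t ∈ K) ↔ w t = -1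
  rw [h₁, h₂, hw t ht hsq]
  exact xor_iff_mul_eq_neg_one (hsign (by omega)) (hsign (by omega))

end Summit.QuantumAdvantage.QuantumAdvantage.Theorems.LiouvilleNotPPoly

end
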